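import Mathlib
import HarnessLib

/-!
# Lorentzian regularisation of a delta function along a fibre, I: local estimates

Helper file for crux `EmbeddedDrudeMourre.MourreDissolution` (item stmt-AtomisticToContinuum-12594,
line `swap-odd-threshold-rigidity`, stub B `stub_freeLevelShift`: the free second-order level shift
of the pinned chain at threshold is ALS's collision form — its fibrewise content is that the
Poisson/Lorentzian regularisation `ν/(Ω² + ν²)` of the energy delta along a partner-momentum fibre
converges to the resolved delta `π Σ_{Ω(k₂)=0} 1/|∂₂Ω|`).

This file: the estimates at ONE simple zero `z` of a function `g` (slope `s = g'(z) ≠ 0`), by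
LINEARISATION (no change of variables):
* `integral_lorentzian_linear`: `∫_{z-r}^{z+r} ν/(s²(x-z)²+ν²) dx = 2 arctan(s r/ν)/s` (arctan
  primitive), `≤ π/|s|`, and `→ π/|s|` as `ν ↓ 0` (`tendsto_two_mul_arctan_div`);
* `abs_lorentzian_sub_lorentzian_linear_le`: if `|g x - s(x-z)| ≤ ε|x-z|` (`ε < |s|`) the Lorentzians
  of `g` and of its linearisation differ by at most `(2|s|+ε)ε/(|s|-ε)²` times the latter;
* `abs_integral_near_zero_sub_le`: hence, with `|φ x - φ z| ≤ ε` on `[z-r, z+r]` and `ε ≤ |s|/2`,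
  `|∫_{z-r}^{z+r} φ ν/(g²+ν²) - φ(z)·2arctan(|s|r/ν)/|s|| ≤ ε(2π/|s| + 10π|φ z|/|s|²)` uniformly in `ν`;
* bookkeeping for finitely many zeros: a common radius (`exists_pos_forall_le`,
  `exists_radius_at_zero`) and a positive lower bound for `|g|` away from the zeros
  (`exists_pos_le_abs_far`).
Part II (`…FibreLorentzian.lean`) assembles the fibre lemma.
-/

noncomputable section

namespace Summit.AtomisticToContinuum.FouriersLaw.Theorems.MourreDissolution.FibreLorentzian

open MeasureTheory Filter Set Topology Real

/-! ## 1. The Lorentzian of a linear function: arctan primitives -/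

/-- Primitive of the Lorentzian of a linear function: `d/dx [arctan(s(x-z)/ν)/s] = ν/(s²(x-z)² + ν²)`
(`s ≠ 0`, `ν ≠ 0`). [folklore] -/
theorem hasDerivAt_arctan_linear {s ν : ℝ} (hs : s ≠ 0) (hν : ν ≠ 0) (z x : ℝ) :
    HasDerivAt (fun x => Real.arctan (s * (x - z) / ν) / s) (ν / (s ^ 2 * (x - z) ^ 2 + ν ^ 2)) x := by
  have h1 : HasDerivAt (fun x => s * (x - z) / ν) (s / ν) x := by
    have := ((hasDerivAt_id x).sub_const z).const_mul s |>.div_const ν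
    simpa using this
  have h2 : HasDerivAt (fun x => Real.arctan (s * (x - z) / ν))
      (1 / (1 + (s * (x - z) / ν) ^ 2) * (s / ν)) x := h1.arctan
  refine (h2.div_const s).congr_deriv ?_
  field_simp
  ring

/-- `∫_{z-r}^{z+r} ν/(s²(x-z)²+ν²) dx = 2 arctan(s r/ν)/s` (`s ≠ 0`, `ν ≠ 0`). [folklore] -/
theorem integral_lorentzian_linear {s ν : ℝ} (hs : s ≠ 0) (hν : ν ≠ 0) (z r : ℝ) :
    ∫ x in (z - r)..(z + r), ν / (s ^ 2 * (x - z) ^ 2 + ν ^ 2) =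
      2 * Real.arctan (s * r / ν) / s := by
  have hcont : Continuous fun x : ℝ => ν / (s ^ 2 * (x - z) ^ 2 + ν ^ 2) := by
    refine continuous_const.div (by fun_prop) (fun x => ?_)
    positivity
  rw [intervalIntegral.integral_eq_sub_of_hasDerivAt (fun x _ => hasDerivAt_arctan_linear hs hν z x)
    (hcont.intervalIntegrable _ _)]
  have e1 : s * (z + r - z) / ν = s * r / ν := by ring
  have e2 : s * (z - r - z) / ν = -(s * r / ν) := by ring
  rw [e1, e2, Real.arctan_neg]
  ring

/-- The value `2 arctan(s r/ν)/s` only depends on `|s|`. [folklore] -/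
theorem two_mul_arctan_div_eq_abs (s r ν : ℝ) :
    2 * Real.arctan (s * r / ν) / s = 2 * Real.arctan (|s| * r / ν) / |s| := by
  rcases le_or_gt 0 s with hs | hs
  · rw [abs_of_nonneg hs]
  · rw [abs_of_neg hs, show -s * r / ν = -(s * r / ν) by ring, Real.arctan_neg, mul_neg, neg_div_neg_eq]

/-- The Lorentzian of a linear function has mass at most `π/|s|` on any interval centred at the zero
(`s ≠ 0`, `ν > 0`). [folklore] -/
theorem integral_lorentzian_linear_le {s ν : ℝ} (hs : s ≠ 0) (hν : 0 < ν) (z r : ℝ) :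
    ∫ x in (z - r)..(z + r), ν / (s ^ 2 * (x - z) ^ 2 + ν ^ 2) ≤ Real.pi / |s| := by
  rw [integral_lorentzian_linear hs hν.ne' z r, two_mul_arctan_div_eq_abs]
  have hs' : 0 < |s| := abs_pos.2 hs
  refine div_le_div_of_nonneg_right ?_ hs'.le
  have := Real.arctan_lt_pi_div_two (|s| * r / ν)
  linarith

/-- `2 arctan(|s| r/ν)/|s| → π/|s|` as `ν ↓ 0` (`s ≠ 0`, `r > 0`). [folklore] -/
theorem tendsto_two_mul_arctan_div {s r : ℝ} (hs : s ≠ 0) (hr : 0 < r) :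
    Tendsto (fun ν : ℝ => 2 * Real.arctan (|s| * r / ν) / |s|) (𝓝[>] 0) (𝓝 (Real.pi / |s|)) := by
  have hs' : 0 < |s| := abs_pos.2 hs
  have h1 : Tendsto (fun ν : ℝ => |s| * r / ν) (𝓝[>] 0) atTop := by
    have : Tendsto (fun ν : ℝ => ν⁻¹) (𝓝[>] 0) atTop := tendsto_inv_nhdsGT_zero
    have h := this.const_mul_atTop (mul_pos hs' hr)
    refine h.congr' (Eventually.of_forall fun ν => ?_)
    simp [div_eq_mul_inv]
  have h2 : Tendsto (fun ν : ℝ => Real.arctan (|s| * r / ν)) (𝓝[>] 0) (𝓝 (Real.pi / 2)) :=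
    (Real.tendsto_arctan_atTop.mono_right nhdsWithin_le_nhds).comp h1
  have h3 := (h2.const_mul 2).div_const |s|
  convert h3 using 2
  ring


/-! ## 2. Pointwise comparison near a simple zero -/

/-- Near a simple zero, the linearisation controls `g` from below:
`|g x - s(x-z)| ≤ ε|x-z|` gives `(|s|-ε)|x-z| ≤ |g x|`. [folklore] -/
theorem abs_linear_sub_le_abs {g : ℝ → ℝ} {s ε z x : ℝ}
    (hx : |g x - s * (x - z)| ≤ ε * |x - z|) : (|s| - ε) * |x - z| ≤ |g x| := by
  have h1 : |s * (x - z)| - |g x| ≤ |g x - s * (x - z)| := by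
    rw [abs_sub_comm]; exact abs_sub_abs_le_abs_sub _ _
  rw [abs_mul] at h1
  nlinarith

/-- Comparison of the Lorentzians of `g` and of its linearisation at a simple zero: if
`|g x - s(x-z)| ≤ ε|x-z|` with `0 ≤ ε < |s|`, then
`|ν/(g x² + ν²) - ν/(s²(x-z)² + ν²)| ≤ ((2|s|+ε)ε/(|s|-ε)²) · ν/(s²(x-z)²+ν²)` (`ν > 0`). [folklore] -/
theorem abs_lorentzian_sub_lorentzian_linear_le {g : ℝ → ℝ} {s ε ν z x : ℝ} (hν : 0 < ν)
    (hε : 0 ≤ ε) (hεs : ε < |s|) (hx : |g x - s * (x - z)| ≤ ε * |x - z|) :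
    |ν / (g x ^ 2 + ν ^ 2) - ν / (s ^ 2 * (x - z) ^ 2 + ν ^ 2)| ≤
      (2 * |s| + ε) * ε / (|s| - ε) ^ 2 * (ν / (s ^ 2 * (x - z) ^ 2 + ν ^ 2)) := by
  set u := x - z with hu
  have hs1 : 0 < |s| - ε := by linarith
  have hlow : (|s| - ε) * |u| ≤ |g x| := abs_linear_sub_le_abs hx
  have hA : 0 < g x ^ 2 + ν ^ 2 := by positivity
  have hB : 0 < s ^ 2 * u ^ 2 + ν ^ 2 := by positivity
  -- `|s²u² - g²| ≤ ε(2|s|+ε) u²`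
  have hdiff : |s ^ 2 * u ^ 2 - g x ^ 2| ≤ ε * (2 * |s| + ε) * u ^ 2 := by
    have e : s ^ 2 * u ^ 2 - g x ^ 2 = (s * u - g x) * (s * u + g x) := by ring
    rw [e, abs_mul]
    have h1 : |s * u - g x| ≤ ε * |u| := by rw [abs_sub_comm]; exact hx
    have h2 : |s * u + g x| ≤ (2 * |s| + ε) * |u| := by
      have hg : |g x| ≤ (|s| + ε) * |u| := by
        have := abs_sub_abs_le_abs_sub (g x) (s * u)
        rw [abs_mul] at this
        nlinarith [abs_nonneg u]
      calc |s * u + g x| ≤ |s * u| + |g x| := abs_add_le _ _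
        _ ≤ |s| * |u| + (|s| + ε) * |u| := by rw [abs_mul]; linarith
        _ = (2 * |s| + ε) * |u| := by ring
    calc |s * u - g x| * |s * u + g x| ≤ (ε * |u|) * ((2 * |s| + ε) * |u|) :=
          mul_le_mul h1 h2 (abs_nonneg _) (by positivity)
      _ = ε * (2 * |s| + ε) * u ^ 2 := by rw [← sq_abs u]; ring
  -- lower bound on the true denominator
  have hAlow : (|s| - ε) ^ 2 * u ^ 2 + ν ^ 2 ≤ g x ^ 2 + ν ^ 2 := by
    have : ((|s| - ε) * |u|) ^ 2 ≤ |g x| ^ 2 := pow_le_pow_left₀ (by positivity) hlow 2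
    rw [mul_pow, sq_abs, sq_abs] at this
    linarith
  have hC : 0 < (|s| - ε) ^ 2 * u ^ 2 + ν ^ 2 := by positivity
  -- the difference of the Lorentzians
  have hsub : ν / (g x ^ 2 + ν ^ 2) - ν / (s ^ 2 * u ^ 2 + ν ^ 2) =
      ν * (s ^ 2 * u ^ 2 - g x ^ 2) / ((g x ^ 2 + ν ^ 2) * (s ^ 2 * u ^ 2 + ν ^ 2)) := by
    field_simp
    ring
  rw [hsub, abs_div, abs_mul, abs_of_pos hν, abs_of_pos (mul_pos hA hB)]
  -- `u²/(g²+ν²) ≤ 1/(|s|-ε)²`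
  have hkey : ν * (ε * (2 * |s| + ε) * u ^ 2) / ((g x ^ 2 + ν ^ 2) * (s ^ 2 * u ^ 2 + ν ^ 2)) ≤
      (2 * |s| + ε) * ε / (|s| - ε) ^ 2 * (ν / (s ^ 2 * u ^ 2 + ν ^ 2)) := by
    rw [div_mul_div_comm, div_le_div_iff₀ (mul_pos hA hB) (by positivity)]
    have hu2 : u ^ 2 * (|s| - ε) ^ 2 ≤ g x ^ 2 + ν ^ 2 := by nlinarith [sq_nonneg ν]
    have hpos : 0 ≤ ν * (ε * (2 * |s| + ε)) * (s ^ 2 * u ^ 2 + ν ^ 2) := by positivity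
    calc ν * (ε * (2 * |s| + ε) * u ^ 2) * ((|s| - ε) ^ 2 * (s ^ 2 * u ^ 2 + ν ^ 2))
        = ν * (ε * (2 * |s| + ε)) * (s ^ 2 * u ^ 2 + ν ^ 2) * (u ^ 2 * (|s| - ε) ^ 2) := by ring
      _ ≤ ν * (ε * (2 * |s| + ε)) * (s ^ 2 * u ^ 2 + ν ^ 2) * (g x ^ 2 + ν ^ 2) :=
          mul_le_mul_of_nonneg_left hu2 hpos
      _ = (2 * |s| + ε) * ε * ν * ((g x ^ 2 + ν ^ 2) * (s ^ 2 * u ^ 2 + ν ^ 2)) := by ring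
  calc ν * |s ^ 2 * u ^ 2 - g x ^ 2| / ((g x ^ 2 + ν ^ 2) * (s ^ 2 * u ^ 2 + ν ^ 2))
      ≤ ν * (ε * (2 * |s| + ε) * u ^ 2) / ((g x ^ 2 + ν ^ 2) * (s ^ 2 * u ^ 2 + ν ^ 2)) := by
        gcongr
    _ ≤ _ := hkey

/-- The Lorentzian of `g` near a simple zero is dominated by the Lorentzian of the slower
linearisation: `ν/(g x²+ν²) ≤ ν/((|s|-ε)²(x-z)²+ν²)`. [folklore] -/
theorem lorentzian_le_lorentzian_linear {g : ℝ → ℝ} {s ε ν z x : ℝ} (hν : 0 < ν)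
    (hεs : ε < |s|) (hx : |g x - s * (x - z)| ≤ ε * |x - z|) :
    ν / (g x ^ 2 + ν ^ 2) ≤ ν / ((|s| - ε) ^ 2 * (x - z) ^ 2 + ν ^ 2) := by
  have hs1 : 0 < |s| - ε := by linarith
  have hlow : (|s| - ε) * |x - z| ≤ |g x| := abs_linear_sub_le_abs hx
  have hAlow : (|s| - ε) ^ 2 * (x - z) ^ 2 + ν ^ 2 ≤ g x ^ 2 + ν ^ 2 := by
    have : ((|s| - ε) * |x - z|) ^ 2 ≤ |g x| ^ 2 := pow_le_pow_left₀ (by positivity) hlow 2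
    rw [mul_pow, sq_abs, sq_abs] at this
    linarith
  exact div_le_div_of_nonneg_left hν.le (by positivity) hAlow


/-! ## 3. The integral near a simple zero -/

/-- **Near-zero estimate.** On `[z-r, z+r]`, if `|g x - s(x-z)| ≤ ε|x-z|` and `|φ x - φ z| ≤ ε` with
`0 ≤ ε ≤ |s|/2`, `s ≠ 0`, then for every `ν > 0`
`|∫_{z-r}^{z+r} φ·ν/(g²+ν²) - φ(z)·2arctan(|s|r/ν)/|s|| ≤ ε (2π/|s| + 10π|φ z|/|s|²)`,
uniformly in `ν`. [folklore] -/
theorem abs_integral_near_zero_sub_le' {g φ : ℝ → ℝ} {s ε ν z r : ℝ} (hν : 0 < ν) (hr : 0 ≤ r)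
    (hε : 0 ≤ ε) (hεs : ε ≤ |s| / 2) (hs : s ≠ 0)
    (hg : ∀ x ∈ Icc (z - r) (z + r), |g x - s * (x - z)| ≤ ε * |x - z|)
    (hφ : ∀ x ∈ Icc (z - r) (z + r), |φ x - φ z| ≤ ε)
    (hint : IntervalIntegrable (fun x => φ x * (ν / (g x ^ 2 + ν ^ 2))) volume (z - r) (z + r)) :
    |(∫ x in (z - r)..(z + r), φ x * (ν / (g x ^ 2 + ν ^ 2))) -
        φ z * (2 * Real.arctan (|s| * r / ν) / |s|)| ≤
      ε * (2 * Real.pi / |s| + 10 * Real.pi * |φ z| / |s| ^ 2) := by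
  have hs0 : 0 < |s| := abs_pos.2 hs
  have hεs' : ε < |s| := by linarith
  have hs1 : 0 < |s| - ε := by linarith
  set κ : ℝ := (2 * |s| + ε) * ε / (|s| - ε) ^ 2 with hκ
  have hκ0 : 0 ≤ κ := by positivity
  -- the three Lorentzians
  set Ls : ℝ → ℝ := fun x => ν / (s ^ 2 * (x - z) ^ 2 + ν ^ 2) with hLs
  set L1 : ℝ → ℝ := fun x => ν / ((|s| - ε) ^ 2 * (x - z) ^ 2 + ν ^ 2) with hL1
  have hLs_cont : Continuous Ls := by
    refine continuous_const.div (by fun_prop) (fun x => ?_); positivity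
  have hL1_cont : Continuous L1 := by
    refine continuous_const.div (by fun_prop) (fun x => ?_); positivity
  have hzr : z - r ≤ z + r := by linarith
  -- the main term is the integral of `φ z · Ls`
  have hmain : ∫ x in (z - r)..(z + r), φ z * Ls x = φ z * (2 * Real.arctan (|s| * r / ν) / |s|) := by
    rw [intervalIntegral.integral_const_mul, hLs]
    simp only []
    rw [integral_lorentzian_linear hs hν.ne' z r, two_mul_arctan_div_eq_abs]
  -- pointwise bound on the difference
  have hpt : ∀ x ∈ Icc (z - r) (z + r),
      |φ x * (ν / (g x ^ 2 + ν ^ 2)) - φ z * Ls x| ≤ ε * L1 x + |φ z| * κ * Ls x := by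
    intro x hx
    have hLg0 : 0 ≤ ν / (g x ^ 2 + ν ^ 2) := by positivity
    have h1 : ν / (g x ^ 2 + ν ^ 2) ≤ L1 x := lorentzian_le_lorentzian_linear hν hεs' (hg x hx)
    have h2 : |ν / (g x ^ 2 + ν ^ 2) - Ls x| ≤ κ * Ls x :=
      abs_lorentzian_sub_lorentzian_linear_le hν hε hεs' (hg x hx)
    have e : φ x * (ν / (g x ^ 2 + ν ^ 2)) - φ z * Ls x =
        (φ x - φ z) * (ν / (g x ^ 2 + ν ^ 2)) + φ z * (ν / (g x ^ 2 + ν ^ 2) - Ls x) := by ring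
    rw [e]
    calc |(φ x - φ z) * (ν / (g x ^ 2 + ν ^ 2)) + φ z * (ν / (g x ^ 2 + ν ^ 2) - Ls x)|
        ≤ |(φ x - φ z) * (ν / (g x ^ 2 + ν ^ 2))| + |φ z * (ν / (g x ^ 2 + ν ^ 2) - Ls x)| :=
          abs_add_le _ _
      _ = |φ x - φ z| * (ν / (g x ^ 2 + ν ^ 2)) + |φ z| * |ν / (g x ^ 2 + ν ^ 2) - Ls x| := by
          rw [abs_mul, abs_mul, abs_of_nonneg hLg0]
      _ ≤ ε * L1 x + |φ z| * (κ * Ls x) := by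
          have hA : |φ x - φ z| * (ν / (g x ^ 2 + ν ^ 2)) ≤ ε * L1 x :=
            le_trans (mul_le_mul_of_nonneg_left h1 (abs_nonneg _))
              (mul_le_mul_of_nonneg_right (hφ x hx) (le_trans hLg0 h1))
          have hB : |φ z| * |ν / (g x ^ 2 + ν ^ 2) - Ls x| ≤ |φ z| * (κ * Ls x) :=
            mul_le_mul_of_nonneg_left h2 (abs_nonneg _)
          exact add_le_add hA hB
      _ = ε * L1 x + |φ z| * κ * Ls x := by ring
  -- integrate the bound
  have hbound_int : IntervalIntegrable (fun x => ε * L1 x + |φ z| * κ * Ls x) volume (z - r) (z + r) :=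
    ((hL1_cont.const_mul ε).add (hLs_cont.const_mul (|φ z| * κ))).intervalIntegrable _ _
  have hdiff_int : IntervalIntegrable (fun x => φ x * (ν / (g x ^ 2 + ν ^ 2)) - φ z * Ls x) volume
      (z - r) (z + r) := hint.sub ((hLs_cont.const_mul (φ z)).intervalIntegrable _ _)
  have hI : |(∫ x in (z - r)..(z + r), φ x * (ν / (g x ^ 2 + ν ^ 2))) -
      φ z * (2 * Real.arctan (|s| * r / ν) / |s|)| ≤
      ∫ x in (z - r)..(z + r), (ε * L1 x + |φ z| * κ * Ls x) := by
    rw [← hmain, ← intervalIntegral.integral_sub hint ((hLs_cont.const_mul (φ z)).intervalIntegrable _ _),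
      ← Real.norm_eq_abs]
    refine intervalIntegral.norm_integral_le_of_norm_le hzr ?_ hbound_int
    refine ae_of_all _ (fun x hx => ?_)
    rw [Real.norm_eq_abs]
    exact hpt x (Ioc_subset_Icc_self hx)
  -- evaluate the bound
  have hval : ∫ x in (z - r)..(z + r), (ε * L1 x + |φ z| * κ * Ls x) ≤
      ε * (Real.pi / (|s| - ε)) + |φ z| * κ * (Real.pi / |s|) := by
    rw [intervalIntegral.integral_add ((hL1_cont.const_mul ε).intervalIntegrable _ _)
      ((hLs_cont.const_mul _).intervalIntegrable _ _),
      intervalIntegral.integral_const_mul, intervalIntegral.integral_const_mul]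
    have hs1' : (|s| - ε) ≠ 0 := hs1.ne'
    have i1 : ∫ x in (z - r)..(z + r), L1 x ≤ Real.pi / (|s| - ε) := by
      have := integral_lorentzian_linear_le (s := |s| - ε) hs1' hν z r
      rwa [abs_of_pos hs1] at this
    have i2 : ∫ x in (z - r)..(z + r), Ls x ≤ Real.pi / |s| := integral_lorentzian_linear_le hs hν z r
    gcongr
  -- constants
  have hc1 : Real.pi / (|s| - ε) ≤ 2 * Real.pi / |s| := by
    rw [div_le_div_iff₀ hs1 hs0]
    nlinarith [Real.pi_pos]
  have hc2 : κ ≤ 10 * ε / |s| := by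
    rw [hκ, div_le_div_iff₀ (by positivity) hs0]
    have h4 : |s| ^ 2 / 4 ≤ (|s| - ε) ^ 2 := by nlinarith
    have h5 : (2 * |s| + ε) ≤ 5 / 2 * |s| := by linarith
    calc (2 * |s| + ε) * ε * |s| ≤ (5 / 2 * |s|) * ε * |s| := by gcongr
      _ = 10 * ε * (|s| ^ 2 / 4) := by ring
      _ ≤ 10 * ε * (|s| - ε) ^ 2 := by gcongr
  calc |(∫ x in (z - r)..(z + r), φ x * (ν / (g x ^ 2 + ν ^ 2))) -
        φ z * (2 * Real.arctan (|s| * r / ν) / |s|)|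
      ≤ ε * (Real.pi / (|s| - ε)) + |φ z| * κ * (Real.pi / |s|) := hI.trans hval
    _ ≤ ε * (2 * Real.pi / |s|) + |φ z| * (10 * ε / |s|) * (Real.pi / |s|) := by
        gcongr
    _ = ε * (2 * Real.pi / |s| + 10 * Real.pi * |φ z| / |s| ^ 2) := by
        field_simp



/-- **Near-zero estimate** (registered helper-stub form of `abs_integral_near_zero_sub_le'`):
`|∫_{z-r}^{z+r} φ·ν/(g²+ν²) - φ(z)·2arctan(|s|r/ν)/|s|| ≤ ε (2π/|s| + 10π|φ z|/|s|²)` uniformly in `ν`.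
[folklore] -/
theorem abs_integral_near_zero_sub_le : ∀ {g φ : ℝ → ℝ} {s ε ν z r : ℝ}, 0 < ν → 0 ≤ r → 0 ≤ ε → ε ≤ |s| / 2 → s ≠ 0 → (∀ x ∈ Set.Icc (z - r) (z + r), |g x - s * (x - z)| ≤ ε * |x - z|) → (∀ x ∈ Set.Icc (z - r) (z + r), |φ x - φ z| ≤ ε) → IntervalIntegrable (fun x => φ x * (ν / (g x ^ 2 + ν ^ 2))) MeasureTheory.volume (z - r) (z + r) → |(∫ x in (z - r)..(z + r), φ x * (ν / (g x ^ 2 + ν ^ 2))) - φ z * (2 * Real.arctan (|s| * r / ν) / |s|)| ≤ ε * (2 * Real.pi / |s| + 10 * Real.pi * |φ z| / |s| ^ 2) :=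
  abs_integral_near_zero_sub_le'

/-! ## 4. Bookkeeping: a common radius, the far region -/

/-- A positive number below finitely many positive numbers. [folklore] -/
theorem exists_pos_forall_le {ι : Type*} (Z : Finset ι) (R : ι → ℝ) (h : ∀ z ∈ Z, 0 < R z) :
    ∃ r : ℝ, 0 < r ∧ ∀ z ∈ Z, r ≤ R z := by
  classical
  induction Z using Finset.induction_on with
  | empty => exact ⟨1, one_pos, by simp⟩
  | insert a Z ha ih =>
    obtain ⟨r, hr, hrZ⟩ := ih (fun z hz => h z (Finset.mem_insert_of_mem hz))
    refine ⟨min r (R a), lt_min hr (h a (Finset.mem_insert_self a Z)), fun z hz => ?_⟩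
    rcases Finset.mem_insert.1 hz with rfl | hz
    · exact min_le_right _ _
    · exact (min_le_left _ _).trans (hrZ z hz)

/-- **Local data at a simple zero.** If `g` has derivative `s` at an interior point `z` of `[a, b]`
and `φ` is continuous at `z`, then for every `ε > 0` there is `ρ > 0` with `[z-ρ, z+ρ] ⊆ (a, b)`,
`|g x - g z - s(x-z)| ≤ ε|x-z|` and `|φ x - φ z| ≤ ε` for `|x - z| ≤ ρ`. [folklore] -/
theorem exists_radius_at_zero {a b : ℝ} {g φ : ℝ → ℝ} {z s ε : ℝ} (hz : z ∈ Ioo a b)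
    (hg : HasDerivAt g s z) (hφ : ContinuousAt φ z) (hε : 0 < ε) :
    ∃ ρ : ℝ, 0 < ρ ∧ Icc (z - ρ) (z + ρ) ⊆ Ioo a b ∧
      (∀ x, |x - z| ≤ ρ → |g x - g z - s * (x - z)| ≤ ε * |x - z|) ∧
      (∀ x, |x - z| ≤ ρ → |φ x - φ z| ≤ ε) := by
  -- derivative: little-o bound
  have h1 : ∀ᶠ x in 𝓝 z, |g x - g z - s * (x - z)| ≤ ε * |x - z| := by
    have ho := (hasDerivAt_iff_isLittleO.1 hg).def hε
    filter_upwards [ho] with x hx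
    simpa [Real.norm_eq_abs, smul_eq_mul, mul_comm] using hx
  obtain ⟨δ₁, hδ₁, hδ₁'⟩ := Metric.eventually_nhds_iff.1 h1
  -- continuity of `φ`
  obtain ⟨δ₂, hδ₂, hδ₂'⟩ := Metric.continuousAt_iff.1 hφ ε hε
  -- interior
  have hza : 0 < z - a := by linarith [hz.1]
  have hzb : 0 < b - z := by linarith [hz.2]
  refine ⟨min (min (δ₁ / 2) (δ₂ / 2)) (min ((z - a) / 2) ((b - z) / 2)), by positivity, ?_, ?_, ?_⟩
  · intro x hx
    have h1 := hx.1; have h2 := hx.2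
    constructor
    · have : min (min (δ₁ / 2) (δ₂ / 2)) (min ((z - a) / 2) ((b - z) / 2)) ≤ (z - a) / 2 :=
        (min_le_right _ _).trans (min_le_left _ _)
      linarith
    · have : min (min (δ₁ / 2) (δ₂ / 2)) (min ((z - a) / 2) ((b - z) / 2)) ≤ (b - z) / 2 :=
        (min_le_right _ _).trans (min_le_right _ _)
      linarith
  · intro x hx
    refine hδ₁' ?_
    rw [Real.dist_eq]
    have : min (min (δ₁ / 2) (δ₂ / 2)) (min ((z - a) / 2) ((b - z) / 2)) ≤ δ₁ / 2 :=
      (min_le_left _ _).trans (min_le_left _ _)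
    linarith
  · intro x hx
    have hd : dist x z < δ₂ := by
      rw [Real.dist_eq]
      have : min (min (δ₁ / 2) (δ₂ / 2)) (min ((z - a) / 2) ((b - z) / 2)) ≤ δ₂ / 2 :=
        (min_le_left _ _).trans (min_le_right _ _)
      linarith
    have := hδ₂' hd
    rw [Real.dist_eq] at this
    exact this.le

/-- **The far region.** Away from the (finitely many) zeros of the continuous function `g` on
`[a, b]`, `|g|` is bounded below by a positive constant. [folklore] -/
theorem exists_pos_le_abs_far {a b : ℝ} {g : ℝ → ℝ} (hgc : ContinuousOn g (Icc a b))
    (Z : Finset ℝ) (hnz : ∀ x ∈ Icc a b, g x = 0 → x ∈ Z) {r : ℝ} (hr : 0 < r) :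
    ∃ c : ℝ, 0 < c ∧ ∀ x ∈ Icc a b, (∀ z ∈ Z, r ≤ |x - z|) → c ≤ |g x| := by
  set K : Set ℝ := Icc a b ∩ {x | ∀ z ∈ Z, r ≤ |x - z|} with hK
  have hKclosed : IsClosed {x : ℝ | ∀ z ∈ Z, r ≤ |x - z|} := by
    have : {x : ℝ | ∀ z ∈ Z, r ≤ |x - z|} = ⋂ z ∈ Z, {x | r ≤ |x - z|} := by
      ext x; simp
    rw [this]
    refine isClosed_biInter (fun z _ => ?_)
    exact isClosed_le continuous_const (continuous_id.sub continuous_const).abs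
  have hKc : IsCompact K := isCompact_Icc.inter_right hKclosed
  have hgK : ContinuousOn (fun x => |g x|) K := (hgc.mono inter_subset_left).abs
  rcases K.eq_empty_or_nonempty with hKe | hKne
  · refine ⟨1, one_pos, fun x hx hfar => ?_⟩
    have : x ∈ K := ⟨hx, hfar⟩
    rw [hKe] at this
    exact this.elim
  · obtain ⟨x₀, hx₀, hmin⟩ := hKc.exists_isMinOn hKne hgK
    have hpos : 0 < |g x₀| := by
      rw [abs_pos]
      intro h0
      have hxZ := hnz x₀ hx₀.1 h0
      have := hx₀.2 x₀ hxZ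
      rw [sub_self, abs_zero] at this
      linarith
    exact ⟨|g x₀|, hpos, fun x hx hfar => hmin ⟨hx, hfar⟩⟩


end Summit.AtomisticToContinuum.FouriersLaw.Theorems.MourreDissolution.FibreLorentzian

end
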